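import Literature.NumberTheory.DiophantineGeometry.FibreConductorJunction
import Literature.NumberTheory.DiophantineGeometry.FibreConductorBadPlaces
import HarnessLib

/-!
# The conductor slope with a DEFECT at the bad places (no `p`-adic separation)

Support lemma for the abc-iut cell's route item GenEllTwo (ledger `stmt-ABC-19679`; [GenEll] =
S. Mochizuki, *Arithmetic elliptic curves in general position*, Math. J. Okayama Univ. **52** (2010),
Thm. 2.1, proof pp. 12–13 — the "sharp Prop. 1.6" step for the reduced fibre of the auxiliary map;
cell work package W5, piece W5d).  This is the DEFECT TWIN of
`FibreConductor.inv_finrank_mul_sum_logNorm_le_slope` (`FibreConductorKappa.lean`) and of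
`FibreConductor.inv_finrank_mul_sum_logNorm_le_slope_of_dichotomy` (`FibreConductorJunction.lean`).

There, the finitely many BAD places `Sbad` were handled by `p`-adic SEPARATION of the point from the
zeros of the ramification form (`hbad₁ : Σ_{w∈Sbad} ord⁺_w(N)·log N(w) ≤ [L:ℚ]·C₁`, supplied by
`FibreConductorBadPlaces.sum_biUnion_placesOver_le`).  Here `hbad₁` is REPLACED by a defect inequality
valid for ALL points, with no separation hypothesis at any finite place:

* `hdef : ∀ w ∈ Sbad, ord⁺_w(N) ≤ Σ_{b∈B} ord⁺_w(t − b) + D(w)` — at a bad place the ramification form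
  still divides the product of the fibre forms UP TO A BOUNDED DENOMINATOR (`D(w)` = the `w`-order of a
  fixed nonzero constant of the curve, independent of the point and of the field), and
* `hD : Σ_{w∈Sbad} D(w)·log N(w) ≤ [L:ℚ]·C₁` — e.g. `D(w) = D_p·e(w∣p)` for `w ∣ p`, `p` in a fixed
  finite set `S` of rational primes, gives `C₁ = Σ_{p∈S} D_p·log p`
  (`sum_biUnion_placesOver_defect_le`, from `Σ_{w∣p} e_w f_w = [L:ℚ]`).

The output is the IDENTICAL `hκ` right-hand side
`((m(e+3) − (3e+3))/e)·(h_L(x)/n) + ((m·C₄ + C₅)/e + m·(C₆ + log 2) + C₁ + C₂ + C₃)`, so the GenEllTwo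
assembly can switch the supplier of the bad-place term without changing any downstream shape.  The proof
is the tree's δ-defect summation `FibreConductor.sum_logNorm_le_of_placewise` with
`d(w) := 1 + D(w)` on `Sbad` and `0` elsewhere, followed by the height bookkeeping of
`FibreConductorKappa.lean`, isolated once and for all as `sum_logNorm_le_slope_of_sum_le`.
No definitions; classical; nothing here refers to the disputed parts of the abc-iut corpus.
[cite: MochizukiGenEll2010, Thm 2.1 proof pp.12-13] [cite: BombieriGubler2006, §2.3]
-/

noncomputable section

open NumberField IsDedekindDomain Height Real Finset
open Literature.IUT.LogVolume

namespace Literature.NumberTheory.DiophantineGeometry.FibreConductor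

variable {L : Type*} [Field L] [NumberField L]

/-! ## The summation over all places with a defect at the bad places -/

/-- **Summation, defect form at the bad places.**  `Sbad` a finite set of finite places; at the GOOD
places the sharp inequalities `1 + ord⁺_w(a) ≤ Σ_i ord⁺_w(τ_i)` (`w ∈ W`) and `ord⁺_w(a) ≤ Σ_i ord⁺_w(τ_i)`
(`w ∉ W`) hold; at a bad place only `ord⁺_w(a) ≤ Σ_i ord⁺_w(τ_i) + D(w)` with
`Σ_{w∈Sbad} D(w)·log N(w) ≤ C`.  Then
`Σ_{w∈W} log N(w) ≤ Σ_i h_L(τ_i) − h_L(a) + A + (C + Σ_{w∈Sbad} log N(w))` — the same right-hand side as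
`sum_logNorm_le_of_good_bad` with the separation constant replaced by the defect constant.
[cite: MochizukiGenEll2010, Thm 2.1 proof pp.12-13] -/
theorem sum_logNorm_le_of_defect {ι : Type*} [Fintype ι] (a : L) (τ : ι → L)
    (W Sbad : Finset (HeightOneSpectrum (𝓞 L))) (D : HeightOneSpectrum (𝓞 L) → ℕ) {A C : ℝ}
    (hmeet : ∀ w ∈ W, w ∉ Sbad → 1 + (ord L w a).toNat ≤ ∑ i, (ord L w (τ i)).toNat)
    (hoff : ∀ w, w ∉ W → w ∉ Sbad → (ord L w a).toNat ≤ ∑ i, (ord L w (τ i)).toNat)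
    (hdef : ∀ w ∈ Sbad, (ord L w a).toNat ≤ (∑ i, (ord L w (τ i)).toNat) + D w)
    (hD : ∑ w ∈ Sbad, (D w : ℝ) * logNorm L w ≤ C)
    (hA : ∑ v : InfinitePlace L, (v.mult : ℝ) * log⁺ (v a⁻¹) ≤ A) :
    ∑ w ∈ W, logNorm L w ≤
      (∑ i, logHeight₁ (τ i)) - logHeight₁ a + A + (C + ∑ w ∈ Sbad, logNorm L w) := by
  classical
  -- total defect: at a bad place the missing `1` of the sharp inequality plus `D(w)`
  let d : HeightOneSpectrum (𝓞 L) → ℕ := fun w => if w ∈ Sbad then 1 + D w else 0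
  refine sum_logNorm_le_of_placewise a τ W Sbad d ?_ ?_ ?_ ?_ hA
  · intro w hw
    by_cases hb : w ∈ Sbad
    · have h := hdef w hb
      simp only [d, if_pos hb]
      omega
    · simp only [d, if_neg hb, add_zero]
      exact hmeet w hw hb
  · intro w hw
    by_cases hb : w ∈ Sbad
    · have h := hdef w hb
      simp only [d, if_pos hb]
      omega
    · simp only [d, if_neg hb, add_zero]
      exact hoff w hw hb
  · intro w hw
    simp [d, hw]
  · have h : ∑ w ∈ Sbad, ((d w : ℕ) : ℝ) * logNorm L w =
        ∑ w ∈ Sbad, (logNorm L w + (D w : ℝ) * logNorm L w) := by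
      refine Finset.sum_congr rfl fun w hw => ?_
      simp only [d, if_pos hw]
      push_cast
      ring
    rw [h, Finset.sum_add_distrib]
    linarith

/-- Monotonicity of the defect inequality in the fibre set: if `ord⁺_w(a) ≤ Σ_{b∈A} ord⁺_w(t − b) + D(w)`
for a SUBSET `A ⊆ B` (e.g. `A` = the critical values of `t`, the only fibres the ramification form can
meet), then the same holds with `B` (the extra terms are nonnegative).
[cite: MochizukiGenEll2010, Thm 2.1 proof pp.12-13] -/
theorem hdef_mono (t a : L) {A B : Finset L} (hAB : A ⊆ B) (Sbad : Finset (HeightOneSpectrum (𝓞 L)))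
    (D : HeightOneSpectrum (𝓞 L) → ℕ)
    (hdef : ∀ w ∈ Sbad, (ord L w a).toNat ≤ (∑ b ∈ A, (ord L w (t - b)).toNat) + D w) :
    ∀ w ∈ Sbad, (ord L w a).toNat ≤ (∑ b ∈ B, (ord L w (t - b)).toNat) + D w := by
  intro w hw
  have hle : ∑ b ∈ A, (ord L w (t - b)).toNat ≤ ∑ b ∈ B, (ord L w (t - b)).toNat :=
    Finset.sum_le_sum_of_subset_of_nonneg hAB fun _ _ _ => Nat.zero_le _
  exact (hdef w hw).trans (Nat.add_le_add_right hle _)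

/-! ## The height bookkeeping of `FibreConductorKappa`, isolated -/

/-- **From the summed inequality to the slope** (the algebra of `FibreConductor.sum_logNorm_le_slope`,
stated once with the summed inequality as a hypothesis so that every supplier of the bad-place term —
separation or defect — can use it): if
`Σ_{w∈W} log N(w) ≤ Σ_{b∈B} h_L(t − b) − h_L(N) + n·C₃ + (n·C₁ + Σ_{w∈Sbad} log N(w))`, then with the
height inputs `ht`, `hN`, `hB` and `Σ_{w∈Sbad} log N(w) ≤ n·C₂` one gets
`Σ_{w∈W} log N(w) ≤ ((m(2k+4) − (6k+6))/(2k+1))·h_L(x) + n·((m·C₄ + C₅)/(2k+1) + m·(C₆ + log 2) + C₁ + C₂ + C₃)`.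
[cite: MochizukiGenEll2010, Thm 2.1 proof pp.12-13] -/
theorem sum_logNorm_le_slope_of_sum_le (k : ℕ) (x t N : L) (B : Finset L)
    (W Sbad : Finset (HeightOneSpectrum (𝓞 L))) {C₁ C₂ C₃ C₄ C₅ C₆ : ℝ}
    (hsum : ∑ w ∈ W, logNorm L w ≤
      (∑ b ∈ B, logHeight₁ (t - b)) - logHeight₁ N + Module.finrank ℚ L * C₃ +
        (Module.finrank ℚ L * C₁ + ∑ w ∈ Sbad, logNorm L w))
    (hbad₂ : ∑ w ∈ Sbad, logNorm L w ≤ Module.finrank ℚ L * C₂)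
    (ht : (2 * k + 1 : ℝ) * logHeight₁ t ≤ (2 * k + 4 : ℝ) * logHeight₁ x + Module.finrank ℚ L * C₄)
    (hN : (6 * k + 6 : ℝ) * logHeight₁ x ≤ (2 * k + 1 : ℝ) * logHeight₁ N + Module.finrank ℚ L * C₅)
    (hB : ∀ b ∈ B, logHeight₁ b ≤ Module.finrank ℚ L * C₆) :
    ∑ w ∈ W, logNorm L w ≤
      ((B.card * (2 * k + 4 : ℝ) - (6 * k + 6)) / (2 * k + 1)) * logHeight₁ x +
        Module.finrank ℚ L * ((B.card * C₄ + C₅) / (2 * k + 1) + B.card * (C₆ + Real.log 2) +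
          C₁ + C₂ + C₃) := by
  set n : ℝ := (Module.finrank ℚ L : ℝ) with hn
  have hnpos : 0 < n := by rw [hn]; exact_mod_cast Module.finrank_pos
  have he : (0 : ℝ) < 2 * k + 1 := by positivity
  -- heights of the differences
  have hdiff := sum_logHeight₁_sub_le t B
  rw [NumberField.totalWeight_eq_finrank] at hdiff
  have hBsum : ∑ b ∈ B, logHeight₁ b ≤ B.card * (n * C₆) := by
    calc ∑ b ∈ B, logHeight₁ b ≤ ∑ b ∈ B, n * C₆ := Finset.sum_le_sum fun b hb => by rw [hn]; exact hB b hb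
      _ = B.card * (n * C₆) := by rw [Finset.sum_const, nsmul_eq_mul]
  -- `m · h(t)` via `ht`, and `−h(N)` via `hN` (divide by `e = 2k+1`)
  have hm0 : (0 : ℝ) ≤ B.card := Nat.cast_nonneg _
  have ht' : logHeight₁ t ≤ ((2 * k + 4 : ℝ) * logHeight₁ x + n * C₄) / (2 * k + 1) := by
    rw [le_div_iff₀ he]; rw [hn]; linarith
  have hN' : -logHeight₁ N ≤ (-(6 * k + 6 : ℝ) * logHeight₁ x + n * C₅) / (2 * k + 1) := by
    rw [le_div_iff₀ he]; rw [hn]; linarith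
  have hmt : (B.card : ℝ) * logHeight₁ t ≤
      B.card * (((2 * k + 4 : ℝ) * logHeight₁ x + n * C₄) / (2 * k + 1)) :=
    mul_le_mul_of_nonneg_left ht' hm0
  have hbad₂' : ∑ w ∈ Sbad, logNorm L w ≤ n * C₂ := by rw [hn]; exact hbad₂
  have hdiff' : ∑ b ∈ B, logHeight₁ (t - b) ≤
      B.card * logHeight₁ t + ∑ b ∈ B, logHeight₁ b + B.card * (n * Real.log 2) := by
    rw [hn]; exact hdiff
  have hsum' : ∑ w ∈ W, logNorm L w ≤
      (∑ b ∈ B, logHeight₁ (t - b)) - logHeight₁ N + n * C₃ + (n * C₁ + ∑ w ∈ Sbad, logNorm L w) := by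
    rw [hn]; exact hsum
  -- assemble
  have htotal : ∑ w ∈ W, logNorm L w ≤
      B.card * (((2 * k + 4 : ℝ) * logHeight₁ x + n * C₄) / (2 * k + 1)) + B.card * (n * C₆) +
        B.card * (n * Real.log 2) + (-(6 * k + 6 : ℝ) * logHeight₁ x + n * C₅) / (2 * k + 1) +
        n * C₃ + (n * C₁ + n * C₂) := by
    linarith
  have halg : B.card * (((2 * k + 4 : ℝ) * logHeight₁ x + n * C₄) / (2 * k + 1)) + B.card * (n * C₆) +
        B.card * (n * Real.log 2) + (-(6 * k + 6 : ℝ) * logHeight₁ x + n * C₅) / (2 * k + 1) +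
        n * C₃ + (n * C₁ + n * C₂) =
      ((B.card * (2 * k + 4 : ℝ) - (6 * k + 6)) / (2 * k + 1)) * logHeight₁ x +
        n * ((B.card * C₄ + C₅) / (2 * k + 1) + B.card * (C₆ + Real.log 2) + C₁ + C₂ + C₃) := by
    field_simp
    ring
  rw [hn] at halg
  rw [hn] at htotal
  linarith [htotal, halg.le, halg.ge]

/-! ## The slope with a defect at the bad places -/

/-- **The conductor slope, defect form (unnormalised).**  As `FibreConductor.sum_logNorm_le_slope`, with
the separation hypothesis `hbad₁` replaced by the defect pair (`hdef`, `hD`):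
`Σ_{w∈W} log N(w) ≤ ((m(e+3) − (3e+3))/e)·h_L(x) + n·((m·C₄ + C₅)/e + m·(C₆ + log 2) + C₁ + C₂ + C₃)`.
[cite: MochizukiGenEll2010, Thm 2.1 proof pp.12-13] -/
theorem sum_logNorm_le_slope_of_defect (k : ℕ) (x t N : L) (B : Finset L)
    (W Sbad : Finset (HeightOneSpectrum (𝓞 L))) (D : HeightOneSpectrum (𝓞 L) → ℕ)
    {C₁ C₂ C₃ C₄ C₅ C₆ : ℝ}
    (hmeet : ∀ w ∈ W, w ∉ Sbad → 1 + (ord L w N).toNat ≤ ∑ b ∈ B, (ord L w (t - b)).toNat)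
    (hoff : ∀ w, w ∉ W → w ∉ Sbad → (ord L w N).toNat ≤ ∑ b ∈ B, (ord L w (t - b)).toNat)
    (hdef : ∀ w ∈ Sbad, (ord L w N).toNat ≤ (∑ b ∈ B, (ord L w (t - b)).toNat) + D w)
    (hD : ∑ w ∈ Sbad, (D w : ℝ) * logNorm L w ≤ Module.finrank ℚ L * C₁)
    (hbad₂ : ∑ w ∈ Sbad, logNorm L w ≤ Module.finrank ℚ L * C₂)
    (harch : ∀ v : InfinitePlace L, log⁺ (v N⁻¹) ≤ C₃)
    (ht : (2 * k + 1 : ℝ) * logHeight₁ t ≤ (2 * k + 4 : ℝ) * logHeight₁ x + Module.finrank ℚ L * C₄)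
    (hN : (6 * k + 6 : ℝ) * logHeight₁ x ≤ (2 * k + 1 : ℝ) * logHeight₁ N + Module.finrank ℚ L * C₅)
    (hB : ∀ b ∈ B, logHeight₁ b ≤ Module.finrank ℚ L * C₆) :
    ∑ w ∈ W, logNorm L w ≤
      ((B.card * (2 * k + 4 : ℝ) - (6 * k + 6)) / (2 * k + 1)) * logHeight₁ x +
        Module.finrank ℚ L * ((B.card * C₄ + C₅) / (2 * k + 1) + B.card * (C₆ + Real.log 2) +
          C₁ + C₂ + C₃) := by
  -- the summation over all places, defect form, with `τ b := t − b` indexed by the subtype of `B`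
  have hA : ∑ v : InfinitePlace L, (v.mult : ℝ) * log⁺ (v N⁻¹) ≤ Module.finrank ℚ L * C₃ :=
    sum_mult_mul_posLog_inv_le_of_forall N harch
  have key := sum_logNorm_le_of_defect (ι := B) N (fun b : B => t - (b : L)) W Sbad D
    (A := Module.finrank ℚ L * C₃) (C := Module.finrank ℚ L * C₁)
    (fun w hw hb => by rw [Finset.sum_coe_sort B (fun b => (ord L w (t - b)).toNat)]; exact hmeet w hw hb)
    (fun w hw hb => by rw [Finset.sum_coe_sort B (fun b => (ord L w (t - b)).toNat)]; exact hoff w hw hb)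
    (fun w hb => by rw [Finset.sum_coe_sort B (fun b => (ord L w (t - b)).toNat)]; exact hdef w hb)
    hD hA
  rw [Finset.sum_coe_sort B (fun b => logHeight₁ (t - b))] at key
  exact sum_logNorm_le_slope_of_sum_le k x t N B W Sbad key hbad₂ ht hN hB

/-- **The conductor slope, defect form, normalised (`hκ` shape).**  As
`FibreConductor.inv_finrank_mul_sum_logNorm_le_slope` with `hbad₁` replaced by (`hdef`, `hD`); the
right-hand side is literally the same:
`(1/n)·Σ_{w∈W} log N(w) ≤ ((m(e+3) − (3e+3))/e)·(h_L(x)/n) + ((m·C₄ + C₅)/e + m·(C₆ + log 2) + C₁ + C₂ + C₃)`.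
[cite: MochizukiGenEll2010, Thm 2.1 proof pp.12-13] -/
theorem inv_finrank_mul_sum_logNorm_le_slope_of_defect (k : ℕ) (x t N : L) (B : Finset L)
    (W Sbad : Finset (HeightOneSpectrum (𝓞 L))) (D : HeightOneSpectrum (𝓞 L) → ℕ)
    {C₁ C₂ C₃ C₄ C₅ C₆ : ℝ}
    (hmeet : ∀ w ∈ W, w ∉ Sbad → 1 + (ord L w N).toNat ≤ ∑ b ∈ B, (ord L w (t - b)).toNat)
    (hoff : ∀ w, w ∉ W → w ∉ Sbad → (ord L w N).toNat ≤ ∑ b ∈ B, (ord L w (t - b)).toNat)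
    (hdef : ∀ w ∈ Sbad, (ord L w N).toNat ≤ (∑ b ∈ B, (ord L w (t - b)).toNat) + D w)
    (hD : ∑ w ∈ Sbad, (D w : ℝ) * logNorm L w ≤ Module.finrank ℚ L * C₁)
    (hbad₂ : ∑ w ∈ Sbad, logNorm L w ≤ Module.finrank ℚ L * C₂)
    (harch : ∀ v : InfinitePlace L, log⁺ (v N⁻¹) ≤ C₃)
    (ht : (2 * k + 1 : ℝ) * logHeight₁ t ≤ (2 * k + 4 : ℝ) * logHeight₁ x + Module.finrank ℚ L * C₄)
    (hN : (6 * k + 6 : ℝ) * logHeight₁ x ≤ (2 * k + 1 : ℝ) * logHeight₁ N + Module.finrank ℚ L * C₅)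
    (hB : ∀ b ∈ B, logHeight₁ b ≤ Module.finrank ℚ L * C₆) :
    (Module.finrank ℚ L : ℝ)⁻¹ * ∑ w ∈ W, logNorm L w ≤
      ((B.card * (2 * k + 4 : ℝ) - (6 * k + 6)) / (2 * k + 1)) *
          ((Module.finrank ℚ L : ℝ)⁻¹ * logHeight₁ x) +
        ((B.card * C₄ + C₅) / (2 * k + 1) + B.card * (C₆ + Real.log 2) + C₁ + C₂ + C₃) := by
  set n : ℝ := (Module.finrank ℚ L : ℝ) with hn
  have hnpos : 0 < n := by rw [hn]; exact_mod_cast Module.finrank_pos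
  have h := sum_logNorm_le_slope_of_defect k x t N B W Sbad D hmeet hoff hdef hD hbad₂ harch ht hN hB
  rw [← hn] at h
  have h' := mul_le_mul_of_nonneg_left h (inv_nonneg.mpr hnpos.le)
  have hc : n⁻¹ * (n * ((B.card * C₄ + C₅) / (2 * k + 1) + B.card * (C₆ + Real.log 2) + C₁ + C₂ + C₃)) =
      (B.card * C₄ + C₅) / (2 * k + 1) + B.card * (C₆ + Real.log 2) + C₁ + C₂ + C₃ := by
    rw [← mul_assoc, inv_mul_cancel₀ hnpos.ne', one_mul]
  have e1 : n⁻¹ * (((B.card * (2 * k + 4 : ℝ) - (6 * k + 6)) / (2 * k + 1)) * logHeight₁ x) =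
      ((B.card * (2 * k + 4 : ℝ) - (6 * k + 6)) / (2 * k + 1)) * (n⁻¹ * logHeight₁ x) := by ring
  rw [mul_add, hc, e1] at h'
  exact h'

/-- **The conductor slope from the dichotomy, the meeting property, and a defect at the bad places**
(`hκ` shape): the twin of `FibreConductor.inv_finrank_mul_sum_logNorm_le_slope_of_dichotomy` — dichotomy
pair and meeting property OFF `Sbad` (W5 (C) + meeting dictionary), defect inequality ON `Sbad`.
[cite: MochizukiGenEll2010, Thm 2.1 proof pp.12-13] -/
theorem inv_finrank_mul_sum_logNorm_le_slope_of_dichotomy_of_defect (k : ℕ) (x t N : L)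
    (B : Finset L) (W Sbad : Finset (HeightOneSpectrum (𝓞 L))) (D : HeightOneSpectrum (𝓞 L) → ℕ)
    {C₁ C₂ C₃ C₄ C₅ C₆ : ℝ}
    (hplace : ∀ w : HeightOneSpectrum (𝓞 L), w ∉ Sbad →
      ((∃ b ∈ B, 0 < ord L w (t - b)) → 1 + (ord L w N).toNat ≤ ∑ b ∈ B, (ord L w (t - b)).toNat) ∧
      ((¬ ∃ b ∈ B, 0 < ord L w (t - b)) → (ord L w N).toNat ≤ ∑ b ∈ B, (ord L w (t - b)).toNat))
    (hW : ∀ w ∈ W, w ∉ Sbad → ∃ b ∈ B, 0 < ord L w (t - b))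
    (hdef : ∀ w ∈ Sbad, (ord L w N).toNat ≤ (∑ b ∈ B, (ord L w (t - b)).toNat) + D w)
    (hD : ∑ w ∈ Sbad, (D w : ℝ) * logNorm L w ≤ Module.finrank ℚ L * C₁)
    (hbad₂ : ∑ w ∈ Sbad, logNorm L w ≤ Module.finrank ℚ L * C₂)
    (harch : ∀ v : InfinitePlace L, log⁺ (v N⁻¹) ≤ C₃)
    (ht : (2 * k + 1 : ℝ) * logHeight₁ t ≤ (2 * k + 4 : ℝ) * logHeight₁ x + Module.finrank ℚ L * C₄)
    (hN : (6 * k + 6 : ℝ) * logHeight₁ x ≤ (2 * k + 1 : ℝ) * logHeight₁ N + Module.finrank ℚ L * C₅)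
    (hB : ∀ b ∈ B, logHeight₁ b ≤ Module.finrank ℚ L * C₆) :
    (Module.finrank ℚ L : ℝ)⁻¹ * ∑ w ∈ W, logNorm L w ≤
      ((B.card * (2 * k + 4 : ℝ) - (6 * k + 6)) / (2 * k + 1)) *
          ((Module.finrank ℚ L : ℝ)⁻¹ * logHeight₁ x) +
        ((B.card * C₄ + C₅) / (2 * k + 1) + B.card * (C₆ + Real.log 2) + C₁ + C₂ + C₃) := by
  obtain ⟨hmeet, hoff⟩ := hmeet_hoff_of_dichotomy t N B W Sbad hplace hW
  exact inv_finrank_mul_sum_logNorm_le_slope_of_defect k x t N B W Sbad D hmeet hoff hdef hD hbad₂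
    harch ht hN hB

/-! ## Per-prime defect weights `D(w) = D_p · e(w ∣ p)` -/

/-- `Σ_{w ∣ p} e_w·log N(w) = [L:ℚ]·log p` (`log N(w) = f_w·log p` and `Σ_{w∣p} e_w f_w = [L:ℚ]`).
[cite: BombieriGubler2006, §1.4] -/
theorem sum_placesOver_ramIdx_mul_logNorm_eq (p : ℕ) [hp : Fact p.Prime] :
    ∑ w ∈ placesOver L p, (ramIdx L w : ℝ) * logNorm L w = (Module.finrank ℚ L : ℝ) * Real.log p := by
  have hterm : ∀ w ∈ placesOver L p,
      (ramIdx L w : ℝ) * logNorm L w = (localDegree L w : ℝ) * Real.log p := by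
    intro w hw
    have hres : residueChar L w = p := (mem_placesOver_iff_residueChar w).mp hw
    rw [logNorm_eq, hres, localDegree, Nat.cast_mul]
    ring
  rw [Finset.sum_congr rfl hterm, ← Finset.sum_mul, ← Nat.cast_sum, sum_localDegree]

/-- A defect `ord⁺_w(a) ≤ Σ + D_p·e_w` at the places over `p` costs `[L:ℚ]·D_p·log p` in the summation:
`Σ_{w ∣ p} (D_p·e_w)·log N(w) = [L:ℚ]·(D_p·log p)`. [cite: BombieriGubler2006, §1.4] -/
theorem sum_placesOver_defect_eq (p : ℕ) [hp : Fact p.Prime] (Dp : ℕ) :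
    ∑ w ∈ placesOver L p, ((Dp * ramIdx L w : ℕ) : ℝ) * logNorm L w =
      (Module.finrank ℚ L : ℝ) * (Dp * Real.log p) := by
  have h : ∀ w ∈ placesOver L p, ((Dp * ramIdx L w : ℕ) : ℝ) * logNorm L w =
      (Dp : ℝ) * ((ramIdx L w : ℝ) * logNorm L w) := by
    intro w _
    push_cast
    ring
  rw [Finset.sum_congr rfl h, ← Finset.mul_sum, sum_placesOver_ramIdx_mul_logNorm_eq]
  ring

open scoped Classical in
/-- The places over distinct rational primes are pairwise disjoint (a place has one residue
characteristic). [cite: BombieriGubler2006, §1.4] -/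
theorem pairwiseDisjoint_placesOver (S : Finset ℕ) (hS : ∀ p ∈ S, p.Prime) :
    (↑S.attach : Set {p // p ∈ S}).PairwiseDisjoint (fun p => placesOver L p.1) := by
  intro p _ q _ hpq
  rw [Function.onFun, Finset.disjoint_left]
  intro w hwp hwq
  apply hpq
  haveI : Fact p.1.Prime := ⟨hS p.1 p.2⟩
  haveI : Fact q.1.Prime := ⟨hS q.1 q.2⟩
  have e1 : residueChar L w = p.1 := (mem_placesOver_iff_residueChar w).mp hwp
  have e2 : residueChar L w = q.1 := (mem_placesOver_iff_residueChar w).mp hwq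
  exact Subtype.ext (e1.symm.trans e2)

open scoped Classical in
/-- The defect sum over `Sbad := ⋃_{p∈S} {w ∣ p}` with `D(w) := D_{p_w}·e_w`:
`Σ_{w∈Sbad} D(w)·log N(w) = [L:ℚ]·Σ_{p∈S} D_p·log p`. [cite: BombieriGubler2006, §1.4] -/
theorem sum_biUnion_placesOver_defect_eq (S : Finset ℕ) (hS : ∀ p ∈ S, p.Prime) (Dp : ℕ → ℕ) :
    ∑ w ∈ S.attach.biUnion (fun p => placesOver L p.1),
        ((Dp (residueChar L w) * ramIdx L w : ℕ) : ℝ) * logNorm L w =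
      (Module.finrank ℚ L : ℝ) * ∑ p ∈ S, (Dp p : ℝ) * Real.log p := by
  rw [Finset.sum_biUnion (pairwiseDisjoint_placesOver S hS)]
  have h3 : ∀ p ∈ S.attach,
      ∑ w ∈ placesOver L p.1, ((Dp (residueChar L w) * ramIdx L w : ℕ) : ℝ) * logNorm L w =
        (Module.finrank ℚ L : ℝ) * ((Dp p.1 : ℝ) * Real.log p.1) := by
    intro p _
    haveI : Fact p.1.Prime := ⟨hS p.1 p.2⟩
    have e0 : ∑ w ∈ placesOver L p.1, ((Dp (residueChar L w) * ramIdx L w : ℕ) : ℝ) * logNorm L w =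
        ∑ w ∈ placesOver L p.1, ((Dp p.1 * ramIdx L w : ℕ) : ℝ) * logNorm L w := by
      refine Finset.sum_congr rfl fun w hw => ?_
      rw [(mem_placesOver_iff_residueChar w).mp hw]
    rw [e0, sum_placesOver_defect_eq]
  rw [Finset.sum_congr rfl h3, ← Finset.mul_sum, Finset.sum_attach S (fun p => (Dp p : ℝ) * Real.log p)]

open scoped Classical in
/-- The trivial conductor bound over `Sbad := ⋃_{p∈S} {w ∣ p}`: `Σ_{w∈Sbad} log N(w) ≤ [L:ℚ]·Σ_{p∈S} log p`.
[cite: BombieriGubler2006, §1.4] -/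
theorem sum_biUnion_placesOver_logNorm_le (S : Finset ℕ) (hS : ∀ p ∈ S, p.Prime) :
    ∑ w ∈ S.attach.biUnion (fun p => placesOver L p.1), logNorm L w ≤
      (Module.finrank ℚ L : ℝ) * ∑ p ∈ S, Real.log p := by
  rw [Finset.sum_biUnion (pairwiseDisjoint_placesOver S hS)]
  have h3 : ∀ p ∈ S.attach, ∑ w ∈ placesOver L p.1, logNorm L w ≤
      (Module.finrank ℚ L : ℝ) * Real.log p.1 := by
    intro p _
    haveI : Fact p.1.Prime := ⟨hS p.1 p.2⟩
    exact sum_placesOver_logNorm_le (L := L) p.1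
  calc ∑ p ∈ S.attach, ∑ w ∈ placesOver L p.1, logNorm L w
      ≤ ∑ p ∈ S.attach, (Module.finrank ℚ L : ℝ) * Real.log p.1 := Finset.sum_le_sum h3
    _ = (Module.finrank ℚ L : ℝ) * ∑ p ∈ S, Real.log p := by
        rw [← Finset.mul_sum, Finset.sum_attach S (fun p => Real.log (p : ℝ))]

open scoped Classical in
/-- **End-to-end, per-prime defects (`hκ` shape).**  Bad places := the places over a fixed finite set `S`
of rational primes; at every `w ∣ p`, `p ∈ S`, the defect inequality
`ord⁺_w(N) ≤ Σ_{b∈B} ord⁺_w(t − b) + D_p·e_w` (no separation); the dichotomy pair and the meeting property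
at the places off `S`; archimedean separation and the three height inputs.  Then `hκ` holds with the
bad-place constants `C₁ := Σ_{p∈S} D_p·log p`, `C₂ := Σ_{p∈S} log p`.
[cite: MochizukiGenEll2010, Thm 2.1 proof pp.12-13] -/
theorem inv_finrank_mul_sum_logNorm_le_slope_of_prime_defect (k : ℕ) (x t N : L) (B : Finset L)
    (W : Finset (HeightOneSpectrum (𝓞 L))) (S : Finset ℕ) (hS : ∀ p ∈ S, p.Prime) (Dp : ℕ → ℕ)
    {C₃ C₄ C₅ C₆ : ℝ}
    (hplace : ∀ w : HeightOneSpectrum (𝓞 L), w ∉ S.attach.biUnion (fun p => placesOver L p.1) →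
      ((∃ b ∈ B, 0 < ord L w (t - b)) → 1 + (ord L w N).toNat ≤ ∑ b ∈ B, (ord L w (t - b)).toNat) ∧
      ((¬ ∃ b ∈ B, 0 < ord L w (t - b)) → (ord L w N).toNat ≤ ∑ b ∈ B, (ord L w (t - b)).toNat))
    (hW : ∀ w ∈ W, w ∉ S.attach.biUnion (fun p => placesOver L p.1) → ∃ b ∈ B, 0 < ord L w (t - b))
    (hδ : ∀ p ∈ S, ∀ w ∈ placesOver L p,
      (ord L w N).toNat ≤ (∑ b ∈ B, (ord L w (t - b)).toNat) + Dp p * ramIdx L w)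
    (harch : ∀ v : InfinitePlace L, log⁺ (v N⁻¹) ≤ C₃)
    (ht : (2 * k + 1 : ℝ) * logHeight₁ t ≤ (2 * k + 4 : ℝ) * logHeight₁ x + Module.finrank ℚ L * C₄)
    (hN : (6 * k + 6 : ℝ) * logHeight₁ x ≤ (2 * k + 1 : ℝ) * logHeight₁ N + Module.finrank ℚ L * C₅)
    (hB : ∀ b ∈ B, logHeight₁ b ≤ Module.finrank ℚ L * C₆) :
    (Module.finrank ℚ L : ℝ)⁻¹ * ∑ w ∈ W, logNorm L w ≤
      ((B.card * (2 * k + 4 : ℝ) - (6 * k + 6)) / (2 * k + 1)) *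
          ((Module.finrank ℚ L : ℝ)⁻¹ * logHeight₁ x) +
        ((B.card * C₄ + C₅) / (2 * k + 1) + B.card * (C₆ + Real.log 2) +
          (∑ p ∈ S, (Dp p : ℝ) * Real.log p) + (∑ p ∈ S, Real.log p) + C₃) := by
  set Sbad := S.attach.biUnion (fun p => placesOver L p.1) with hSbad
  let D : HeightOneSpectrum (𝓞 L) → ℕ := fun w => Dp (residueChar L w) * ramIdx L w
  -- the defect inequality at every bad place, with `D(w) = D_{p_w}·e_w`
  have hdef : ∀ w ∈ Sbad, (ord L w N).toNat ≤ (∑ b ∈ B, (ord L w (t - b)).toNat) + D w := by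
    intro w hw
    rw [hSbad, Finset.mem_biUnion] at hw
    obtain ⟨p, _, hwp⟩ := hw
    haveI : Fact p.1.Prime := ⟨hS p.1 p.2⟩
    have hres : residueChar L w = p.1 := (mem_placesOver_iff_residueChar w).mp hwp
    simp only [D, hres]
    exact hδ p.1 p.2 w hwp
  have hD : ∑ w ∈ Sbad, (D w : ℝ) * logNorm L w ≤
      Module.finrank ℚ L * ∑ p ∈ S, (Dp p : ℝ) * Real.log p :=
    (sum_biUnion_placesOver_defect_eq S hS Dp).le
  have hbad₂ : ∑ w ∈ Sbad, logNorm L w ≤ Module.finrank ℚ L * ∑ p ∈ S, Real.log p :=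
    sum_biUnion_placesOver_logNorm_le S hS
  exact inv_finrank_mul_sum_logNorm_le_slope_of_dichotomy_of_defect k x t N B W Sbad D hplace hW hdef
    hD hbad₂ harch ht hN hB

end Literature.NumberTheory.DiophantineGeometry.FibreConductor
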